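import Literature.Analysis.FluidPDE.NSGaldiEnergyEqualityProofs
import Literature.Analysis.FluidPDE.NSLionsEnergyEquality
import Literature.Analysis.FluidPDE.WeakSolutionWeakContinuity
import Literature.Analysis.FluidPDE.LerayHopfSpatialGradient
import Literature.Analysis.FunctionSpaces.SobolevDomainProofs
import HarnessLib

/-!
# Discharge of Galdi's energy equality theorem (and of Lions' layer)

Proof file for the named fact `Literature.Analysis.FluidPDE.galdi_energy_equality`
(`FluidPDE/NSLerayHopf`; Galdi 2019, Proc. AMS 147, Thm. 1.1: a distributional solution of the
unforced Navier–Stokes system on `ℝ³ × (0,T)` with datum `u₀ ∈ L²_σ` lying in `L⁴(0,T; L⁴)` is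
in the Leray–Hopf class and satisfies the energy equality) and for the second named fact of its
accepted decomposition (`FluidPDE/NSGaldiEnergyEquality`; the first, the class assertion, is
`galdi_lerayHopf_class_holds` of `FluidPDE/NSGaldiEnergyEqualityProofs`):

* `Literature.Analysis.FluidPDE.lions_energy_equality_L4_holds` — Lions' energy equality in
  `L⁴(0,T; L⁴(ℝ³))` (Lions 1960; Sohr 2001, Thm. V.1.4.1): pass to the weakly `L²`-continuous
  representative (`IsWeakNSSolutionOn.exists_weaklyContinuousOn_version`), choose a jointly
  measurable version of the weak gradient (`exists_stronglyMeasurable_of_sliced_weakGradient`),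
  apply `lions_identity` (`FluidPDE/NSLionsEnergyEquality`, Serrin's doubling argument) at every
  `t ∈ (0,T]`, and return to the given solution and gradient at a.e. `t` (uniqueness of weak
  gradients, `HasWeakFDerivOn.unique_holds`; the dissipation integrals as Bochner integrals,
  `integral_sum_integral_inner_apply_self_eq_toReal`).
* `Literature.Analysis.FluidPDE.galdi_energy_equality_holds` — the fact itself, through the
  accepted assembly `galdi_energy_equality_of` from the class assertion
  (`galdi_lerayHopf_class_holds`: `IsWeakNSSolutionOn.memLqLp_top_two_of_L4` of
  `NSGaldiEnergyClass` and `IsWeakNSSolutionOn.exists_weakGradient_of_L4` of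
  `NSGaldiVorticityL2`) and Lions' layer.

The tree's proof of the class assertion is not Galdi's printed one (invading domains, Galerkin
approximation of the adjoint Oseen problem, Bogovskiĭ's density lemma) but the whole-space heat
duality: the very weak formulation is tested with backward Duhamel integrals of curl-type fields
(`NSGaldiExtendedTest`, `NSGaldiDualityIdentity`), bounded by the `L¹ₜL²ₓ` energy estimate and by
maximal `L²` regularity of the heat flow (`NSGaldiDualityBounds`); the resulting functionals are
represented in `L²` (`L2DualityTools`, `DivCurlAnnihilator`, `NSGaldiEnergyClass`,
`NSGaldiVorticityL2`) and the weak gradient is recovered from the weak vorticity by the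
`div`–`curl` identity (`NSGaldiDivCurlWeak`). No new definitions.

## References

* G. P. Galdi, *On the energy equality for distributional solutions to Navier–Stokes equations*,
  Proc. Amer. Math. Soc. 147 (2019), 785–792 (arXiv:1710.05725), Thm. 1.1. Bib key `Galdi2018`.
* J.-L. Lions, *Sur la régularité et l'unicité des solutions turbulentes des équations de Navier
  Stokes*, Rend. Sem. Mat. Univ. Padova 30 (1960), 16–23.
* H. Sohr, *The Navier–Stokes equations*, Birkhäuser 2001, Ch. V, Thm. 1.4.1. Bib key `Sohr2001`.
* J. Serrin, *The initial value problem for the Navier–Stokes equations*, 1963, §4. Bib key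
  `Serrin1963`.
-/

noncomputable section

open MeasureTheory TopologicalSpace Set Function Filter Topology InnerProductSpace
open scoped RealInnerProductSpace ENNReal NNReal

namespace Literature.Analysis.FluidPDE

variable {E : Type*} [NormedAddCommGroup E] [InnerProductSpace ℝ E] [FiniteDimensional ℝ E]
  [MeasurableSpace E] [BorelSpace E]

/-! ### Bookkeeping: dissipation integrals as Bochner integrals -/

section Dissipation

/-- For a gradient field with finite Frobenius mass, `Σᵢ ∫ ⟪G eᵢ, G eᵢ⟫ = (∫⁻ |G|²).toReal`.
[folklore] -/
theorem sum_integral_inner_apply_self_eq_toReal {G : E → E →L[ℝ] E} (hG : AEStronglyMeasurable G volume)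
    (hG2 : ∫⁻ x, ENNReal.ofReal (frobeniusNormSq (G x)) < ⊤) :
    ∑ i, ∫ x, ⟪G x (stdOrthonormalBasis ℝ E i), G x (stdOrthonormalBasis ℝ E i)⟫ =
      (∫⁻ x, ENNReal.ofReal (frobeniusNormSq (G x))).toReal := by
  set b := stdOrthonormalBasis ℝ E
  rw [lintegral_ofReal_frobeniusNormSq_eq_sum hG]
  have hfin : ∀ i, ∫⁻ x, ‖G x (b i)‖ₑ ^ (2 : ℝ) < ⊤ := fun i => by
    refine lt_of_le_of_lt ?_ hG2
    rw [lintegral_ofReal_frobeniusNormSq_eq_sum hG]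
    exact Finset.single_le_sum (f := fun j => ∫⁻ x, ‖G x (b j)‖ₑ ^ (2 : ℝ)) (fun j _ => zero_le)
      (Finset.mem_univ i)
  rw [ENNReal.toReal_sum fun i _ => (hfin i).ne]
  refine Finset.sum_congr rfl fun i _ => ?_
  have hm : AEStronglyMeasurable (fun x => G x (b i)) volume :=
    (ContinuousLinearMap.apply ℝ E (b i)).continuous.comp_aestronglyMeasurable hG
  have hmem : MemLp (fun x => G x (b i)) 2 volume := by
    refine ⟨hm, ?_⟩
    rw [eLpNorm_eq_lintegral_rpow_enorm_toReal two_ne_zero ENNReal.ofNat_ne_top, ENNReal.toReal_ofNat]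
    exact ENNReal.rpow_lt_top_of_nonneg (by norm_num) (hfin i).ne
  have hint : Integrable (fun x => ‖G x (b i)‖ ^ 2) volume := hmem.integrable_norm_pow two_ne_zero
  simp_rw [real_inner_self_eq_norm_sq]
  rw [integral_eq_lintegral_of_nonneg_ae (Eventually.of_forall fun x => sq_nonneg _)
    hint.aestronglyMeasurable]
  congr 1
  refine lintegral_congr fun x => ?_
  rw [← ofReal_norm, ENNReal.ofReal_rpow_of_nonneg (norm_nonneg _) zero_le_two, Real.rpow_two]

/-- The time integral of the slice dissipations as a Bochner integral:
`∫₀ᵗ Σᵢ ∫⟪G eᵢ, G eᵢ⟫ = (∫⁻₀ᵗ ∫⁻ |G|²).toReal` for a jointly measurable `G` of finite dissipation.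
[folklore] -/
theorem integral_sum_integral_inner_apply_self_eq_toReal {T t : ℝ} (htT : t ≤ T)
    {G : ℝ → E → E →L[ℝ] E} (hGm : StronglyMeasurable (uncurry G))
    (hG₂ : ∫⁻ s in Ioo 0 T, ∫⁻ x, ENNReal.ofReal (frobeniusNormSq (G s x)) < ⊤) :
    ∫ s in Ioo 0 t, ∑ i, ∫ x, ⟪G s x (stdOrthonormalBasis ℝ E i), G s x (stdOrthonormalBasis ℝ E i)⟫ =
      (∫⁻ s in Ioo 0 t, ∫⁻ x, ENNReal.ofReal (frobeniusNormSq (G s x))).toReal := by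
  have hG₂t := lintegral_Ioo_mono_lt_top htT hG₂
  have hDm : Measurable fun s => ∫⁻ x, ENNReal.ofReal (frobeniusNormSq (G s x)) :=
    measurable_lintegral_frobeniusNormSq hGm
  have hfin : ∀ᵐ s ∂(volume.restrict (Ioo 0 t)), ∫⁻ x, ENNReal.ofReal (frobeniusNormSq (G s x)) < ⊤ :=
    ae_lt_top hDm hG₂t.ne
  rw [← integral_toReal hDm.aemeasurable hfin]
  refine integral_congr_ae ?_
  filter_upwards [hfin] with s hs
  have hGs : AEStronglyMeasurable (G s) volume :=
    (hGm.comp_measurable (measurable_const.prodMk measurable_id)).aestronglyMeasurable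
  exact sum_integral_inner_apply_self_eq_toReal hGs hs

end Dissipation

/-! ### Lions' energy equality in `L⁴(0,T; L⁴(ℝ³))` -/

/-- **Discharge of `lions_energy_equality_L4`** (Lions 1960; Sohr 2001, Thm. V.1.4.1 with
`s = q = 4`, `n = 3`). Given a weak solution `u` on `ℝ³ × [0,T)` with datum `u₀ ∈ L²_σ`, in
`L^∞(0,T; L²)` with a square-integrable slice-wise weak gradient `G` and in `L⁴(0,T; L⁴)`:
pass to the weakly `L²`-continuous representative `v` (`= u` at a.e. time, `v(0) = u₀`;
`IsWeakNSSolutionOn.exists_weaklyContinuousOn_version`), choose a jointly measurable version of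
`G` (`exists_stronglyMeasurable_of_sliced_weakGradient`), apply `lions_identity` at every
`t ∈ (0,T]`, and return to `u` and `G` at a.e. `t` (uniqueness of weak gradients,
`HasWeakFDerivOn.unique_holds`). [cite: Sohr2001, Ch. V Thm. 1.4.1 with (1.4.6)] -/
theorem lions_energy_equality_L4_holds : lions_energy_equality_L4 := by
  intro ν T hν hT u₀ u hu₀ hdiv₀ hw h₂ G hG hG₂ h₄
  have hE3 : Module.finrank ℝ (EuclideanSpace ℝ (Fin 3)) = 3 := finrank_euclideanSpace_fin
  set b := stdOrthonormalBasis ℝ (EuclideanSpace ℝ (Fin 3)) with hb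
  -- ### the weakly continuous representative
  obtain ⟨v, hvu, hv0, hvL2, hvw, hvdiv, hvcont⟩ := hw.exists_weaklyContinuousOn_version hT h₂ hu₀ hdiv₀
  set N : ℝ≥0∞ := eLqLpNorm ∞ 2 u (Ioo 0 T) with hN
  have hNtop : N ≠ ⊤ := h₂.2.ne
  set M : ℝ := N.toReal with hM
  have hNM : N = ENNReal.ofReal M := (ENNReal.ofReal_toReal hNtop).symm
  have hvL2' : ∀ t ∈ Icc 0 T, MemLp (v t) 2 volume ∧ eLpNorm (v t) 2 volume ≤ ENNReal.ofReal M :=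
    fun t ht => ⟨(hvL2 t ht).1, hNM ▸ (hvL2 t ht).2⟩
  have hvu' : ∀ᵐ t ∂(volume.restrict (Ioo 0 T)), v t =ᵐ[volume] u t :=
    hvu.mono fun t ht => by rw [ht]
  have huv' : ∀ᵐ t ∂(volume.restrict (Ioo 0 T)), u t =ᵐ[volume] v t :=
    hvu.mono fun t ht => by rw [ht]
  have hvE : MemLqLp ∞ 2 v (Ioo 0 T) := h₂.congr_ae_slice hvu'
  have hv4 : MemLqLp 4 4 v (Ioo 0 T) := h₄.congr_ae_slice hvu'
  have hvG : ∀ᵐ t ∂(volume.restrict (Ioo 0 T)), HasWeakGradient (v t) (G t) := by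
    filter_upwards [hG, hvu] with t ht htv
    rw [htv]; exact ht
  -- ### jointly measurable versions of `v` and `G`
  have hvm := hvw.aestronglyMeasurable_uncurry
  set vt : ℝ × EuclideanSpace ℝ (Fin 3) → EuclideanSpace ℝ (Fin 3) := hvm.mk (uncurry v) with hvt_def
  have hvtm : StronglyMeasurable vt := hvm.stronglyMeasurable_mk
  have hvt : uncurry v =ᵐ[(volume.restrict (Ioo 0 T)).prod (volume : Measure (EuclideanSpace ℝ (Fin 3)))] vt :=
    hvm.ae_eq_mk
  have hsl : ∀ᵐ t ∂(volume.restrict (Ioo 0 T)), v t =ᵐ[volume] fun x => vt (t, x) :=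
    ae_slice_eq_of_uncurry_ae_eq hvt
  have hvtG : ∀ᵐ t ∂(volume.restrict (Ioo 0 T)), HasWeakGradient (fun y => vt (t, y)) (G t) := by
    filter_upwards [hvG, hsl] with t ht hts
    exact ht.congr_ae hts.symm
  obtain ⟨G'', hG''m, hG''⟩ := exists_stronglyMeasurable_of_sliced_weakGradient hvtm hvtG
  set Gu : ℝ → EuclideanSpace ℝ (Fin 3) → EuclideanSpace ℝ (Fin 3) →L[ℝ] EuclideanSpace ℝ (Fin 3) :=
    fun t x => G'' (t, x) with hGu
  have hGum : StronglyMeasurable (uncurry Gu) := by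
    have : uncurry Gu = G'' := by funext p; rfl
    rw [this]; exact hG''m
  have hGuG : ∀ᵐ t ∂(volume.restrict (Ioo 0 T)), Gu t =ᵐ[volume] G t := hG''
  have hGuv : ∀ᵐ t ∂(volume.restrict (Ioo 0 T)), HasWeakGradient (v t) (Gu t) := by
    filter_upwards [hvG, hGuG] with t ht htG
    exact ht.congr_grad_ae htG
  have hDeq : ∀ᵐ t ∂(volume.restrict (Ioo 0 T)), (∫⁻ x, ENNReal.ofReal (frobeniusNormSq (Gu t x))) =
      ∫⁻ x, ENNReal.ofReal (frobeniusNormSq (G t x)) := by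
    filter_upwards [hGuG] with t ht
    exact lintegral_congr_ae (ht.mono fun x hx => by dsimp only; rw [hx])
  have hGu₂ : ∫⁻ t in Ioo 0 T, ∫⁻ x, ENNReal.ofReal (frobeniusNormSq (Gu t x)) < ⊤ := by
    rw [lintegral_congr_ae hDeq]; exact hG₂
  -- ### Lions' identity for `v`
  have hid : ∀ t ∈ Ioc 0 T, ∫ x, ⟪v t x, v t x⟫ = (∫ x, ⟪u₀ x, u₀ x⟫) -
      2 * ν * ∫ s in Ioo 0 t, ∑ i, ∫ x, ⟪Gu s x (b i), Gu s x (b i)⟫ := fun t ht =>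
    lions_identity hE3 hT hvw hu₀ hv0 hvE ENNReal.toReal_nonneg hvL2' hvdiv hvcont hv4 hGum hGuv hGu₂
      hvtm hvt ht
  -- ### back to `u` and `G`
  have hEq : ∀ {w : EuclideanSpace ℝ (Fin 3) → EuclideanSpace ℝ (Fin 3)}, MemLp w 2 volume →
      VectorCalculus.kineticEnergy w = 2⁻¹ * ∫ x, ⟪w x, w x⟫ := fun hw2 => by
    rw [VectorCalculus.kineticEnergy]
    congr 1
    exact integral_congr_ae (Eventually.of_forall fun x => (real_inner_self_eq_norm_sq _).symm)
  filter_upwards [hvu, ae_restrict_mem measurableSet_Ioo] with t htv ht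
  have htT : t ∈ Ioc 0 T := ⟨ht.1, ht.2.le⟩
  have h1 := hid t htT
  -- the dissipation of `G` on `(0,t)` equals that of `Gu`
  have hDt : (∫⁻ τ in Ioo 0 t, ∫⁻ x, ENNReal.ofReal (frobeniusNormSq (G τ x))) =
      ∫⁻ τ in Ioo 0 t, ∫⁻ x, ENNReal.ofReal (frobeniusNormSq (Gu τ x)) := by
    refine lintegral_congr_ae ?_
    exact (ae_restrict_of_ae_restrict_of_subset (Ioo_subset_Ioo le_rfl ht.2.le) hDeq).mono
      fun τ hτ => hτ.symm
  rw [hDt, ← integral_sum_integral_inner_apply_self_eq_toReal ht.2.le hGum hGu₂, ← htv,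
    hEq (hvL2 t ⟨ht.1.le, ht.2.le⟩).1, hEq hu₀, h1]
  ring

/-! ### Galdi's class assertion and the energy equality -/

/-- **Discharge of `galdi_energy_equality`** (Galdi 2019, Proc. AMS 147, Thm. 1.1): a
distributional solution of the unforced Navier–Stokes system on `ℝ³ × (0,T)` with datum
`u₀ ∈ L²_σ` lying in `L⁴(0,T; L⁴)` is in the Leray–Hopf class and satisfies the energy
equality — from the class assertion (`galdi_lerayHopf_class_holds`) and Lions' energy equality
in `L⁴(0,T; L⁴)` (`lions_energy_equality_L4_holds`) through the accepted assembly
`galdi_energy_equality_of`. [cite: Galdi2018, Thm 1.1] -/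
theorem galdi_energy_equality_holds : galdi_energy_equality :=
  galdi_energy_equality_of galdi_lerayHopf_class_holds lions_energy_equality_L4_holds

end Literature.Analysis.FluidPDE
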